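import Mathlib
import HarnessLib
import Literature.MathematicalPhysics.KineticTheory.HardSphereEulerProofs
import Summits.AtomisticToContinuum.HydrodynamicLimit.Theses.OneFlightGossipEngine
import Summits.AtomisticToContinuum.HydrodynamicLimit.Theorems.OneFlightGossipEngineKineticCurrentsWindowLDSplit
import Summits.AtomisticToContinuum.HydrodynamicLimit.Theorems.OneFlightGossipEngineKineticCurrentsLDAlongFamiliesTransferByNets

/-!
# Pointwise radial window tails — stub `stub_radialTailsAt` (S10) of line `Sketch`,
# crux `KineticCurrentsLDAlongFamilies` (stmt-AtomisticToContinuum-16659)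

Route `OneFlightGossipEngine`, sub-problem `HydrodynamicLimit`, stub S10 of the skeleton
`Cruxes/KineticCurrentsLDAlongFamilies/Lines/Sketch.lean` (v5, radial reshape). Decay-free glue:
the pointwise kinetic-window LD rung for the RADIAL sector of the class (S1R, hypothesis `hKR`:
exponential moments of `Σᵢ w⁻¹∫₀ʷ F(Φ_r z i) dr`, `F(x,v) = K(x, ‖v − u₀(x)‖²)`, `K` continuous of
growth `C(1+‖v‖²)` and orthogonal to `1, v_j, ‖v‖²` under `M_{1,u₀(x),θ₀(x)}`, with a numeric tilt
threshold `β₀(Θ,U,C,Λ,σ)`) and the static radial tail dominator (S8, hypothesis `hD`: for bounds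
`(Θ,U)` constants `C_K, L ≥ 0` and for every `κ > 0` a level `V ≥ 1` and, for each profile, a radial
`K` in the sector with `0 ≤ K + κ`, `max 0 (‖v‖² − V) ≤ L (K + κ)`) give exponential tightness of
the window-averaged suprathermal kinetic energy `Σᵢ w⁻¹∫₀ʷ max 0 (‖vᵢ(r)‖² − V) dr` under the local
Gibbs law of ONE profile: `γ₀ := β₁/(L+1)` with `β₁ = β₀(Θ,U,C_K,Λ,σ)`, and for `0 ≤ γ ≤ γ₀`,
`κ > 0` the level `V` of S8 at `κ_D = κ/(2(β₁+1))`; pathwise on good orbits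
(`intervalIntegrable_comp_orbit`) `γ·Σᵢ w⁻¹∫₀ʷ max 0 (‖vᵢ‖² − V) ≤ γLκ_D(N+1) + γL·Σᵢ w⁻¹∫₀ʷ K`, so the
rung at tilt `γL ≤ β₁` and precision `κ/2` gives the bound `exp(κ(N+1))`.

References: S. Olla, S. R. S. Varadhan, H.-T. Yau, Comm. Math. Phys. 155 (1993) §2 (exponential
moment currency); H. Spohn, *Large Scale Dynamics of Interacting Particles* (1991), Part I §2.3.
-/

noncomputable section

open MeasureTheory Set Filter
open scoped ENNReal Topology

namespace Summit.AtomisticToContinuum.HydrodynamicLimit.Theorems.KineticCurrentsLDAlongFamiliesSketch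

open Literature.Analysis.FluidPDE (HardSphereFlow Config localMaxwellian canonicalDensity liouville)
open Literature.MathematicalPhysics.KineticTheory (T3 V3 hsDiameter localGibbsLaw localGibbsMeasure
  localGibbsProfile)
open Literature.Analysis.FluidPDE Literature.MathematicalPhysics.KineticTheory

/-- **Pathwise domination of window exponential moments.** For a law `μ` carried by the good set
of a hard-sphere flow on `𝕋³`, continuous one-body observables `T, D` with `T ≤ L (D + c)`
pointwise, a window `w > 0` and a tilt `γ ≥ 0`: along every good orbit both
`r ↦ T(Φ_r z i)` and `r ↦ D(Φ_r z i)` are interval integrable, so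
`γ Σᵢ w⁻¹∫₀ʷ T(Φ_r z i) dr ≤ γ L c n + γ L Σᵢ w⁻¹∫₀ʷ D(Φ_r z i) dr`, whence
`∫ exp(γ Σᵢ w⁻¹∫₀ʷ T) dμ ≤ e^{γ L c n} ∫ exp(γ L Σᵢ w⁻¹∫₀ʷ D) dμ`. [folklore] -/
theorem rta_lintegral_exp_window_le_of_dom {ε : ℝ} {n : ℕ}
    (Φ : HardSphereFlow (Torus.geometry (Fin 3)) ε n) {μ : Measure (Config n (Fin 3) T3)}
    (hμ : μ Φ.goodᶜ = 0) {T D : T3 × V3 → ℝ} (hT : Continuous T) (hD : Continuous D)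
    {L c : ℝ} (hdom : ∀ y, T y ≤ L * (D y + c))
    {w : ℝ} (hw : 0 < w) {γ : ℝ} (hγ : 0 ≤ γ) :
    ∫⁻ z, ENNReal.ofReal (Real.exp (γ * ∑ i, w⁻¹ * ∫ r in (0 : ℝ)..w, T (Φ.flow r z i))) ∂μ ≤
      ENNReal.ofReal (Real.exp (γ * L * c * n)) *
        ∫⁻ z, ENNReal.ofReal (Real.exp (γ * L * ∑ i, w⁻¹ * ∫ r in (0 : ℝ)..w,
          D (Φ.flow r z i))) ∂μ := by
  have hgood : ∀ᵐ z ∂μ, z ∈ Φ.good :=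
    measure_eq_zero_iff_ae_notMem.1 hμ |>.mono fun z hz => by simpa using hz
  refine (lintegral_mono_ae ?_).trans_eq (lintegral_const_mul' _ _ ENNReal.ofReal_ne_top)
  filter_upwards [hgood] with z hz
  rw [← ENNReal.ofReal_mul (Real.exp_nonneg _), ← Real.exp_add]
  refine ENNReal.ofReal_le_ofReal (Real.exp_le_exp.2 ?_)
  have hi : ∀ i, γ * (w⁻¹ * ∫ r in (0 : ℝ)..w, T (Φ.flow r z i)) ≤
      γ * L * c + γ * L * (w⁻¹ * ∫ r in (0 : ℝ)..w, D (Φ.flow r z i)) := by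
    intro i
    have hTi := intervalIntegrable_comp_orbit Φ hz hT i 0 w
    have hDi := intervalIntegrable_comp_orbit Φ hz hD i 0 w
    have hGi : IntervalIntegrable (fun r => L * (D (Φ.flow r z i) + c)) volume 0 w :=
      (hDi.add intervalIntegrable_const).const_mul L
    have h := intervalIntegral.integral_mono_on hw.le hTi hGi fun r _ => hdom (Φ.flow r z i)
    rw [intervalIntegral.integral_const_mul, intervalIntegral.integral_add hDi
      intervalIntegrable_const, intervalIntegral.integral_const, sub_zero, smul_eq_mul] at h
    have h1 : γ * (w⁻¹ * ∫ r in (0 : ℝ)..w, T (Φ.flow r z i)) ≤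
        γ * (w⁻¹ * (L * ((∫ r in (0 : ℝ)..w, D (Φ.flow r z i)) + w * c))) :=
      mul_le_mul_of_nonneg_left (mul_le_mul_of_nonneg_left h (inv_pos.2 hw).le) hγ
    refine h1.trans_eq ?_
    calc γ * (w⁻¹ * (L * ((∫ r in (0 : ℝ)..w, D (Φ.flow r z i)) + w * c)))
        = γ * L * c * (w⁻¹ * w) + γ * L * (w⁻¹ * ∫ r in (0 : ℝ)..w, D (Φ.flow r z i)) := by
          ring
      _ = γ * L * c + γ * L * (w⁻¹ * ∫ r in (0 : ℝ)..w, D (Φ.flow r z i)) := by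
          rw [inv_mul_cancel₀ hw.ne', mul_one]
  calc γ * ∑ i, w⁻¹ * ∫ r in (0 : ℝ)..w, T (Φ.flow r z i)
      = ∑ i, γ * (w⁻¹ * ∫ r in (0 : ℝ)..w, T (Φ.flow r z i)) := Finset.mul_sum _ _ _
    _ ≤ ∑ i, (γ * L * c + γ * L * (w⁻¹ * ∫ r in (0 : ℝ)..w, D (Φ.flow r z i))) :=
        Finset.sum_le_sum fun i _ => hi i
    _ = γ * L * c * n + γ * L * ∑ i, w⁻¹ * ∫ r in (0 : ℝ)..w, D (Φ.flow r z i) := by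
        rw [Finset.sum_add_distrib, Finset.sum_const, Finset.card_univ, Fintype.card_fin,
          nsmul_eq_mul, Finset.mul_sum]
        ring

/-- **S10 — pointwise radial window tails** (stub `stub_radialTailsAt` of line `Sketch`, crux
`KineticCurrentsLDAlongFamilies`, stmt-AtomisticToContinuum-16659): the pointwise rung for the
radial sector (S1R, hypothesis) and the static radial tail dominator (S8, hypothesis) give
exponential tightness of the window-averaged suprathermal kinetic energy
`Σᵢ w⁻¹∫₀ʷ max 0 (‖vᵢ(r)‖² − V) dr` under the local Gibbs law of one profile, with thresholds
`η := η₀^{S1R}`, `γ₀ := β₁/(L+1)` (`β₁ = β₀^{S1R}(Θ,U,C_K,Λ,σ)`), `V := V^{S8}(κ/(2(β₁+1)))`,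
and `τ₀, N₀` those of S1R for the dominating member `K(x,‖v − u₀(x)‖²)` at tilt `γL` and precision
`κ/2`; the two bounds are chained by `rta_lintegral_exp_window_le_of_dom`. [folklore] -/
theorem stub_radialTailsAt :
    (∃ η₀ : ℝ, 0 < η₀ ∧ ∀ (Θ U C Λ : ℝ), 1 ≤ Θ → 0 ≤ U → 0 ≤ C → 1 ≤ Λ → ∀ σ : ℝ, 0 < σ →
        ∃ β₀ : ℝ, 0 < β₀ ∧
        ∀ (a θ₀ : T3 → ℝ) (u₀ : T3 → V3), Continuous a → Continuous θ₀ → Continuous u₀ →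
        (∀ x, Λ⁻¹ ≤ a x ∧ a x ≤ Λ) → (∀ x, Θ⁻¹ ≤ θ₀ x ∧ θ₀ x ≤ Θ) → (∀ x, ‖u₀ x‖ ≤ U) →
        σ ^ 3 * (⨆ x, a x) ≤ η₀ * ∫ x, a x →
        ∀ Φ : (N : ℕ) → HardSphereFlow (Torus.geometry (Fin 3)) (hsDiameter σ N) (N + 1),
        ∀ K : T3 × ℝ → ℝ, Continuous K →
        ∀ F : T3 × V3 → ℝ, (∀ y, F y = K (y.1, ‖y.2 - u₀ y.1‖ ^ 2)) →
        (∀ y, |F y| ≤ C * (1 + ‖y.2‖ ^ 2)) →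
        (∀ x, ∫ v, F (x, v) * localMaxwellian 1 (θ₀ x) (u₀ x) v = 0) →
        (∀ x (j : Fin 3), ∫ v, F (x, v) * v j * localMaxwellian 1 (θ₀ x) (u₀ x) v = 0) →
        (∀ x, ∫ v, F (x, v) * ‖v‖ ^ 2 * localMaxwellian 1 (θ₀ x) (u₀ x) v = 0) →
        ∀ β : ℝ, |β| ≤ β₀ → ∀ ε : ℝ, 0 < ε → ∃ τ₀ : ℝ, 0 < τ₀ ∧ ∀ τ : ℝ, τ₀ ≤ τ →
        ∃ N₀ : ℕ, ∀ N : ℕ, N₀ ≤ N →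
          ∫⁻ z, ENNReal.ofReal (Real.exp (β * ∑ i : Fin (N + 1),
              (τ * ((N : ℝ) + 1) ^ (-(1 / 3 : ℝ)))⁻¹ *
                ∫ r in (0 : ℝ)..(τ * ((N : ℝ) + 1) ^ (-(1 / 3 : ℝ))), F (((Φ N).flow r z) i)))
            ∂(localGibbsLaw σ a u₀ θ₀ N (Φ N)) ≤
          ENNReal.ofReal (Real.exp (ε * ((N : ℝ) + 1)))) →
    (∀ (Θ U : ℝ), 1 ≤ Θ → 0 ≤ U → ∃ CK L : ℝ, 0 ≤ CK ∧ 0 ≤ L ∧ ∀ κ : ℝ, 0 < κ →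
        ∃ V : ℝ, 1 ≤ V ∧ ∀ (θ₀ : T3 → ℝ) (u₀ : T3 → V3), Continuous θ₀ → Continuous u₀ →
        (∀ x, Θ⁻¹ ≤ θ₀ x ∧ θ₀ x ≤ Θ) → (∀ x, ‖u₀ x‖ ≤ U) →
        ∃ K : T3 × ℝ → ℝ, Continuous K ∧
        (∀ (x : T3) (v : V3), |K (x, ‖v - u₀ x‖ ^ 2)| ≤ CK * (1 + ‖v‖ ^ 2)) ∧
        (∀ x, ∫ v, K (x, ‖v - u₀ x‖ ^ 2) * localMaxwellian 1 (θ₀ x) (u₀ x) v = 0) ∧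
        (∀ x (j : Fin 3), ∫ v, K (x, ‖v - u₀ x‖ ^ 2) * v j * localMaxwellian 1 (θ₀ x) (u₀ x) v = 0) ∧
        (∀ x, ∫ v, K (x, ‖v - u₀ x‖ ^ 2) * ‖v‖ ^ 2 * localMaxwellian 1 (θ₀ x) (u₀ x) v = 0) ∧
        (∀ (x : T3) (v : V3), 0 ≤ K (x, ‖v - u₀ x‖ ^ 2) + κ) ∧
        ∀ (x : T3) (v : V3), max 0 (‖v‖ ^ 2 - V) ≤ L * (K (x, ‖v - u₀ x‖ ^ 2) + κ)) →
    ∃ η : ℝ, 0 < η ∧ ∀ (Θ U Λ : ℝ), 1 ≤ Θ → 0 ≤ U → 1 ≤ Λ → ∀ σ : ℝ, 0 < σ →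
        ∃ γ₀ : ℝ, 0 < γ₀ ∧ ∀ γ : ℝ, 0 ≤ γ → γ ≤ γ₀ → ∀ κ : ℝ, 0 < κ → ∃ V : ℝ, 1 ≤ V ∧
        ∀ (a θ₀ : T3 → ℝ) (u₀ : T3 → V3), Continuous a → Continuous θ₀ → Continuous u₀ →
        (∀ x, Λ⁻¹ ≤ a x ∧ a x ≤ Λ) → (∀ x, Θ⁻¹ ≤ θ₀ x ∧ θ₀ x ≤ Θ) → (∀ x, ‖u₀ x‖ ≤ U) →
        σ ^ 3 * (⨆ x, a x) ≤ η * ∫ x, a x →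
        ∀ Φ : (N : ℕ) → HardSphereFlow (Torus.geometry (Fin 3)) (hsDiameter σ N) (N + 1),
        ∃ τ₀ : ℝ, 0 < τ₀ ∧ ∀ τ : ℝ, τ₀ ≤ τ → ∃ N₀ : ℕ, ∀ N : ℕ, N₀ ≤ N →
          ∫⁻ z, ENNReal.ofReal (Real.exp (γ * ∑ i : Fin (N + 1),
              (τ * ((N : ℝ) + 1) ^ (-(1 / 3 : ℝ)))⁻¹ *
                ∫ r in (0 : ℝ)..(τ * ((N : ℝ) + 1) ^ (-(1 / 3 : ℝ))),
                  max 0 (‖(((Φ N).flow r z) i).2‖ ^ 2 - V)))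
            ∂(localGibbsLaw σ a u₀ θ₀ N (Φ N)) ≤
          ENNReal.ofReal (Real.exp (κ * ((N : ℝ) + 1))) := by
  rintro ⟨η₀, hη₀, hK'⟩ hD
  refine ⟨η₀, hη₀, ?_⟩
  intro Θ U Λ hΘ hU hΛ σ hσ
  -- the constants of the dominator (S8) and the tilt threshold of the radial rung (S1R) at `C_K`
  obtain ⟨CK, L, hCK, hL, hD1⟩ := hD Θ U hΘ hU
  obtain ⟨β₁, hβ₁, hK1⟩ := hK' Θ U CK Λ hΘ hU hCK hΛ σ hσ
  refine ⟨β₁ / (L + 1), by positivity, ?_⟩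
  intro γ hγ0 hγ κ hκ
  -- the level `V` of the dominator at precision `κ_D = κ / (2 (β₁ + 1))`
  have hκD : 0 < κ / (2 * (β₁ + 1)) := by positivity
  obtain ⟨V, hV1, hD2⟩ := hD1 (κ / (2 * (β₁ + 1))) hκD
  refine ⟨V, hV1, ?_⟩
  intro a θ₀ u₀ ha hθ hu hΛb hΘb hUb hguard Φ
  obtain ⟨K, hKc, hKg, hK0, hKv, hKE, -, hKdom⟩ := hD2 θ₀ u₀ hθ hu hΘb hUb
  -- the tilt `γ L ≤ β₁`
  have hγL1 : γ * (L + 1) ≤ β₁ := (le_div_iff₀ (by positivity)).1 hγ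
  have hγL' : γ * L ≤ β₁ := by nlinarith
  have hγL : |γ * L| ≤ β₁ := by rwa [abs_of_nonneg (mul_nonneg hγ0 hL)]
  -- the radial rung (S1R) for the dominating member at tilt `γ L` and precision `κ / 2`
  obtain ⟨τ₀, hτ₀, hτ⟩ := hK1 a θ₀ u₀ ha hθ hu hΛb hΘb hUb hguard Φ K hKc
    (fun y => K (y.1, ‖y.2 - u₀ y.1‖ ^ 2)) (fun y => rfl) (fun y => hKg y.1 y.2) hK0 hKv hKE
    (γ * L) hγL (κ / 2) (by positivity)
  refine ⟨τ₀, hτ₀, fun τ hτ' => ?_⟩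
  obtain ⟨N₀, hN⟩ := hτ τ hτ'
  refine ⟨N₀, fun N hN' => ?_⟩
  have hτpos : 0 < τ := hτ₀.trans_le hτ'
  have hw : 0 < τ * ((N : ℝ) + 1) ^ (-(1 / 3 : ℝ)) :=
    mul_pos hτpos (Real.rpow_pos_of_pos (by positivity) _)
  have hPgood : (localGibbsLaw σ a u₀ θ₀ N (Φ N)) (Φ N).goodᶜ = 0 :=
    localGibbsLaw_absolutelyContinuous σ _ _ _ N (Φ N) (Φ N).measure_compl_good
  have hTc : Continuous fun y : T3 × V3 => max 0 (‖y.2‖ ^ 2 - V) :=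
    continuous_const.max ((continuous_snd.norm.pow 2).sub continuous_const)
  have hDc : Continuous fun y : T3 × V3 => K (y.1, ‖y.2 - u₀ y.1‖ ^ 2) :=
    hKc.comp (continuous_fst.prodMk ((continuous_snd.sub (hu.comp continuous_fst)).norm.pow 2))
  have hdom : ∀ y : T3 × V3,
      max 0 (‖y.2‖ ^ 2 - V) ≤ L * (K (y.1, ‖y.2 - u₀ y.1‖ ^ 2) + κ / (2 * (β₁ + 1))) :=
    fun y => hKdom y.1 y.2
  -- pathwise domination, then the rung, then `γ L κ_D + κ/2 ≤ κ`
  have key := rta_lintegral_exp_window_le_of_dom (Φ N) hPgood hTc hDc hdom hw hγ0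
  refine (key.trans (mul_le_mul' le_rfl (hN N hN'))).trans ?_
  rw [← ENNReal.ofReal_mul (Real.exp_pos _).le, ← Real.exp_add]
  refine ENNReal.ofReal_le_ofReal (Real.exp_le_exp.2 ?_)
  have hn : (0 : ℝ) ≤ (N : ℝ) + 1 := by positivity
  have h1 : γ * L * (κ / (2 * (β₁ + 1))) ≤ κ / 2 := by
    have hb : (β₁ + 1) ≠ 0 := by positivity
    calc γ * L * (κ / (2 * (β₁ + 1))) ≤ (β₁ + 1) * (κ / (2 * (β₁ + 1))) :=
          mul_le_mul_of_nonneg_right (by linarith) hκD.le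
      _ = κ / 2 := by rw [mul_div_assoc', mul_comm (2 : ℝ), mul_div_mul_left _ _ hb]
  have h2 := mul_le_mul_of_nonneg_right h1 hn
  push_cast
  nlinarith [h2]

end Summit.AtomisticToContinuum.HydrodynamicLimit.Theorems.KineticCurrentsLDAlongFamiliesSketch

end
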